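import Summits.SmoothPoincare4.SmoothPoincare4.Theorems.ConvexBisectionAcyclicBisectionExistsCrossingNumberRescale
import Summits.SmoothPoincare4.SmoothPoincare4.Theorems.ConvexBisectionAcyclicBisectionExistsCrossingNumberMultiPassage
import Mathlib.Analysis.Calculus.Deriv.MeanValue
import HarnessLib

/-!
# Counting crossings, I: local tools (sign persistence, level gaps, one clean passage)
(wave 5, brick X7-1a of the counting step (iv) of the symmetry statement (R1)
`crossingNumber_symm` for the missing lemma `crossingNumber_eq_stdSymp` of node N1a of stub
`stub_modelsOnFibred_of_reach` = NF4, line `modp-braid-orbits`, crux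
`ConvexBisection.AcyclicBisectionExists`, item stmt-SmoothPoincare4-10508; registered sub-goal
`helper_crossing_clean_passage`)

Z6-REPORT §3 (R1)(iv): the crossing number `crossingNumber φ K` of a page loop `K` with an
annulus chart `φ` is COUNTED at a regular level `k` of the transverse coordinate
`f t = height φ (K e^{2πit})`: near each solution `u` of `f u = k` with `f` `C¹` and `f' u ≠ 0`
the loop makes ONE clean passage through a thin collar `φ(ℝ × [k − η/2, k + η/2])` of the
re-profiled chart `φ_{k,η} (u, r) = φ (u, k + η r)` (`…CrossingNumberRescale.lean`), and misses
that collar elsewhere.  This file supplies the local tools of that count: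

* §1 real analysis: `exists_Icc_deriv_sign` (a `C¹` function with `f' u ≠ 0` is continuous with
  a derivative of constant sign on some `[u − ρ, u + ρ]`), `exists_pos_le_finset` (a positive
  lower bound of finitely many positive reals);
* §2 `exists_level_gap` — on a compact parameter set avoiding the solutions of `f = k`, the loop
  stays off a whole strip `φ(ℝ × [k − η, k + η])` (extreme value theorem for `|f − k|`, the
  transverse coordinate being continuous on the page at annulus points,
  `continuousWithinAt_height`);
* §3 membership in the annulus / collar of the re-profiled chart in terms of `height φ`
  (`mem_annulus_reprofile`, `height_of_mem_collar_reprofile`, `outerInd_reprofile`);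
* §4 **`exists_clean_passage`** / `helper_crossing_clean_passage` — around a solution `u`
  (`f` continuous and strictly monotone up to sign `σ = ±1` on `[u − ρ, u + ρ]`, the end points
  off the strip of half-width `η`) there are `s < t` in `[u − ρ, u + ρ]` with the loop inside the
  annulus of `φ_{k,η}` on `[s, t]`, off its collar on `[u − ρ, u + ρ] ∖ (s, t)`, and net passage
  `outerInd (K e^{2πit}) − outerInd (K e^{2πis}) = σ`.

Everything is proved; no definitions, no named facts, no `sorry`.  References: W. Fulton,
*Algebraic Topology: A First Course* (1995), §3 (degree by counting signed preimages)
[Fulton1995]; B. Farb, D. Margalit, *A primer on mapping class groups* (2012), §6.1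
[FarbMargalit2012].
-/

noncomputable section

set_option linter.dupNamespace false

open scoped Manifold ContDiff Topology Real
open Set Function Metric Filter
open Literature.Topology.FourManifolds Literature.Topology.FourManifolds.LefschetzBase

namespace Summit.SmoothPoincare4.SmoothPoincare4.Theorems.AcyclicBisectionExists.ModpBraidOrbits

variable {g : ℕ} {c : ℂ} {φ : ℝ × ℝ → Base g} {K : sphere (0 : EuclideanSpace ℝ (Fin 2)) 1 → Base g}

/-! ## §1 Real analysis -/

/-- **Sign persistence of a `C¹` derivative**: if `f` is `C¹` at `u` with `deriv f u ≠ 0`, then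
on some `[u − ρ, u + ρ]` the function is continuous and its derivative has the sign of
`deriv f u`. [folklore] -/
theorem exists_Icc_deriv_sign {f : ℝ → ℝ} {u : ℝ} (hf : ContDiffAt ℝ 1 f u) (hu : deriv f u ≠ 0) :
    ∃ ρ > 0, ContinuousOn f (Icc (u - ρ) (u + ρ)) ∧
      ∀ y ∈ Icc (u - ρ) (u + ρ), 0 < deriv f u * deriv f y := by
  obtain ⟨f', U, hU, hf'c, hf'⟩ := contDiffAt_one_iff.1 hf
  have hderiv : ∀ y ∈ U, deriv f y = f' y 1 := fun y hy => by
    rw [(hf' y hy).hasDerivAt.deriv]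
  have hcF : ContinuousAt (fun y => deriv f u * f' y 1) u :=
    continuousAt_const.mul
      ((ContinuousLinearMap.apply ℝ ℝ (1 : ℝ)).continuous.continuousAt.comp (hf'c.continuousAt hU))
  have h0 : 0 < deriv f u * f' u 1 := by
    rw [← hderiv u (mem_of_mem_nhds hU)]
    exact mul_self_pos.2 hu
  have hev : ∀ᶠ y in 𝓝 u, y ∈ U ∧ 0 < deriv f u * f' y 1 :=
    (eventually_of_mem hU fun y hy => hy).and (hcF.eventually (lt_mem_nhds h0))
  obtain ⟨ε, hε, hball⟩ := Metric.mem_nhds_iff.1 hev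
  have hsub : ∀ y ∈ Icc (u - ε / 2) (u + ε / 2), y ∈ U ∧ 0 < deriv f u * f' y 1 := by
    intro y hy
    have hyb : y ∈ ball u ε := by
      rw [Real.ball_eq_Ioo]; exact ⟨by linarith [hy.1], by linarith [hy.2]⟩
    exact hball hyb
  refine ⟨ε / 2, by linarith, fun y hy => ?_, fun y hy => ?_⟩
  · exact (hf' y (hsub y hy).1).continuousAt.continuousWithinAt
  · rw [hderiv y (hsub y hy).1]
    exact (hsub y hy).2

/-- **A positive lower bound of finitely many positive reals.** [folklore] -/
theorem exists_pos_le_finset {ι : Type*} (S : Finset ι) {r : ι → ℝ} (hr : ∀ u ∈ S, 0 < r u) :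
    ∃ ρ > 0, ∀ u ∈ S, ρ ≤ r u := by
  classical
  induction S using Finset.induction_on with
  | empty => exact ⟨1, one_pos, by simp⟩
  | insert a S _ ih =>
    obtain ⟨ρ, hρ, hρS⟩ := ih fun u hu => hr u (Finset.mem_insert_of_mem hu)
    refine ⟨min ρ (r a), lt_min hρ (hr a (Finset.mem_insert_self a S)), fun u hu => ?_⟩
    rcases Finset.mem_insert.1 hu with rfl | hu
    · exact min_le_right _ _
    · exact (min_le_left _ _).trans (hρS u hu)

/-! ## §2 A level gap off the solutions -/

/-- **A uniform level gap**: if, on a compact parameter set `T`, the loop `K` never meets the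
level `height φ = k` inside the open annulus (`|k| < 1/2`), then for some `0 < η ≤ 1/4` it stays
off the closed strip `φ(ℝ × [k − η, k + η])` on `T` (extreme value theorem for `|height − k|`,
continuous on the compact trace of the strip `φ(ℝ × [k − 1/4, k + 1/4])`). [folklore] -/
theorem exists_level_gap (hc : ‖c‖ = 1) (hφc : Continuous φ) (hφ1 : ∀ u r, φ (u + 1, r) = φ (u, r))
    (hφp : ∀ p, φ p ∈ page g c) (hφi : InjOn φ (Ico (0 : ℝ) 1 ×ˢ Ioo (-1 : ℝ) 1))
    (hK : Continuous K) (hKc : ∀ θ, K θ ∈ page g c) {k : ℝ} (hk : k ∈ Ioo (-(1 / 2) : ℝ) (1 / 2))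
    {T : Set ℝ} (hT : IsCompact T)
    (hTk : ∀ t ∈ T, K (circlePt t) ∈ φ '' (univ ×ˢ Ioo (-1 : ℝ) 1) → height φ (K (circlePt t)) ≠ k) :
    ∃ η, 0 < η ∧ η ≤ 1 / 4 ∧ ∀ t ∈ T, K (circlePt t) ∉ φ '' (univ ×ˢ Icc (k - η) (k + η)) := by
  have hL : Continuous fun t : ℝ => K (circlePt t) := hK.comp continuous_circlePt
  set T' : Set ℝ := T ∩ (fun t : ℝ => K (circlePt t)) ⁻¹' (φ '' (univ ×ˢ Icc (k - 1 / 4) (k + 1 / 4)))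
    with hT'
  have hT'c : IsCompact T' :=
    hT.inter_right (((isCompact_image_Icc hφc hφ1 _ _).isClosed).preimage hL)
  have hsub : Icc (k - 1 / 4) (k + 1 / 4) ⊆ Ioo (-1 : ℝ) 1 :=
    Icc_subset_Ioo (by linarith [hk.1]) (by linarith [hk.2])
  have hA : ∀ t ∈ T', K (circlePt t) ∈ φ '' (univ ×ˢ Ioo (-1 : ℝ) 1) := fun t ht =>
    image_mono (Set.prod_mono Subset.rfl hsub) ht.2
  have hF : ContinuousOn (fun t => |height φ (K (circlePt t)) - k|) T' := by
    intro t ht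
    have h1 := continuousWithinAt_height hc hφc hφ1 hφp hφi (hA t ht)
    have h2 : ContinuousWithinAt (fun t : ℝ => K (circlePt t)) univ t :=
      hL.continuousAt.continuousWithinAt
    have h3 := ContinuousWithinAt.comp (f := fun t : ℝ => K (circlePt t)) (x := t) h1 h2
      (fun t _ => hKc _)
    have h4 : ContinuousAt (fun t : ℝ => height φ (K (circlePt t))) t := h3.continuousAt univ_mem
    exact ((h4.sub continuousAt_const).abs).continuousWithinAt
  have hpos : ∀ t ∈ T', 0 < |height φ (K (circlePt t)) - k| := fun t ht =>
    abs_pos.2 (sub_ne_zero.2 (hTk t ht.1 (hA t ht)))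
  obtain ⟨η', hη', hη'le⟩ := hT'c.exists_forall_le' hF hpos
  refine ⟨min (η' / 2) (1 / 4), lt_min (by linarith) (by norm_num), min_le_right _ _,
    fun t ht hmem => ?_⟩
  obtain ⟨p, ⟨-, hp⟩, hpt⟩ := hmem
  have hm4 : min (η' / 2) (1 / 4) ≤ 1 / 4 := min_le_right _ _
  have hm2 : min (η' / 2) (1 / 4) ≤ η' / 2 := min_le_left _ _
  have hpI : p.2 ∈ Icc (k - 1 / 4) (k + 1 / 4) := ⟨by linarith [hp.1], by linarith [hp.2]⟩
  have ht' : t ∈ T' := ⟨ht, p, ⟨trivial, hpI⟩, hpt⟩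
  have hh : height φ (K (circlePt t)) = p.2 := by
    rw [← hpt]; exact height_of_lift hφ1 hφi (u₀ := p.1) (r₀ := p.2) (hsub hpI)
  have h1 := hη'le t ht'
  rw [hh] at h1
  have h2 : |p.2 - k| ≤ min (η' / 2) (1 / 4) := abs_sub_le_iff.2 ⟨by linarith [hp.2], by linarith [hp.1]⟩
  linarith

/-! ## §3 The annulus and the collar of the re-profiled chart, read through `height φ` -/

/-- **A point of the open annulus whose height is within `η` of `k` lies in the open annulus of
the re-profiled chart `φ_{k,η}`.** [folklore] -/
theorem mem_annulus_reprofile {k η : ℝ} (hη : 0 < η) {q : Base g}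
    (hq : q ∈ φ '' (univ ×ˢ Ioo (-1 : ℝ) 1)) (hh : |height φ q - k| < η) :
    q ∈ (fun p : ℝ × ℝ => φ (p.1, k + η * p.2)) '' (univ ×ˢ Ioo (-1 : ℝ) 1) := by
  obtain ⟨h2, hq'⟩ := prelift_spec hq
  refine ⟨((prelift φ q).1, (height φ q - k) / η), ⟨trivial, ?_⟩, ?_⟩
  · rw [abs_lt] at hh
    exact ⟨by rw [lt_div_iff₀ hη]; linarith, by rw [div_lt_iff₀ hη]; linarith⟩
  · show φ ((prelift φ q).1, k + η * ((height φ q - k) / η)) = q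
    rw [mul_div_cancel₀ _ hη.ne', add_sub_cancel, height, Prod.mk.eta, hq']

/-- **A point of the closed collar of `φ_{k,η}` (`0 < η`, `|k| + η ≤ 1`) lies in the open annulus
of `φ` at height within `η/2` of `k`.** [folklore] -/
theorem height_of_mem_collar_reprofile (hφ1 : ∀ u r, φ (u + 1, r) = φ (u, r))
    (hφi : InjOn φ (Ico (0 : ℝ) 1 ×ˢ Ioo (-1 : ℝ) 1)) {k η : ℝ} (hη : 0 < η) (hkη : |k| + η ≤ 1)
    {q : Base g}
    (hq : q ∈ (fun p : ℝ × ℝ => φ (p.1, k + η * p.2)) '' (univ ×ˢ Icc (-(1 / 2) : ℝ) (1 / 2))) :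
    q ∈ φ '' (univ ×ˢ Ioo (-1 : ℝ) 1) ∧ |height φ q - k| ≤ η / 2 := by
  obtain ⟨p, ⟨-, hp⟩, rfl⟩ := hq
  have hp' : p.2 ∈ Ioo (-1 : ℝ) 1 := ⟨by linarith [hp.1], by linarith [hp.2]⟩
  have hr : k + η * p.2 ∈ Ioo (-1 : ℝ) 1 := affine_mem_Ioo hη hkη hp'
  refine ⟨⟨(p.1, k + η * p.2), ⟨trivial, hr⟩, rfl⟩, ?_⟩
  show |height φ (φ (p.1, k + η * p.2)) - k| ≤ η / 2
  rw [height_of_lift hφ1 hφi hr, add_sub_cancel_left, abs_mul, abs_of_pos hη]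
  have : |p.2| ≤ 1 / 2 := abs_le.2 ⟨hp.1, hp.2⟩
  nlinarith

/-- **The outer indicator of `φ_{k,η}` at a point of height `k + η r`** (`r ∈ (−1, 1)`): `1` if
`r ≥ 1/2`, `0` otherwise. [folklore] -/
theorem outerInd_reprofile (hφ1 : ∀ u r, φ (u + 1, r) = φ (u, r))
    (hφi : InjOn φ (Ico (0 : ℝ) 1 ×ˢ Ioo (-1 : ℝ) 1)) {k η : ℝ} (hη : 0 < η) (hkη : |k| + η ≤ 1)
    {v r : ℝ} (hr : r ∈ Ioo (-1 : ℝ) 1) :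
    outerInd (fun p : ℝ × ℝ => φ (p.1, k + η * p.2)) (φ (v, k + η * r)) = if 1 / 2 ≤ r then 1 else 0 := by
  classical
  have hA : φ (v, k + η * r) ∈ (fun p : ℝ × ℝ => φ (p.1, k + η * p.2)) '' (univ ×ˢ Ioo (-1 : ℝ) 1) :=
    ⟨(v, r), ⟨trivial, hr⟩, rfl⟩
  have hh : height (fun p : ℝ × ℝ => φ (p.1, k + η * p.2)) (φ (v, k + η * r)) = r :=
    height_of_lift (reprofile_periodic hφ1 k η) (reprofile_injOn hφi hη hkη) (u₀ := v) (r₀ := r) hr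
  rw [outerInd, hh]
  by_cases h : 1 / 2 ≤ r
  · rw [if_pos ⟨hA, h⟩, if_pos h]
  · rw [if_neg (fun h' => h h'.2), if_neg h]

/-! ## §4 One clean passage near a transversal solution -/

/-- **One clean passage.**  Let `|k| < 1/2`, `0 < η ≤ 1/4`, `0 < ρ`, `σ = ±1`; suppose the loop
`K` runs inside the open annulus of `φ` on `[u − ρ, u + ρ]`, the function
`t ↦ σ (height φ (K e^{2πit}) − k)` is continuous and strictly increasing there and vanishes at
`u`, and the two end points are off the strip `φ(ℝ × [k − η, k + η])`.  Then for some
`u − ρ ≤ s < t ≤ u + ρ` the loop is inside the open annulus of the re-profiled chart `φ_{k,η}` on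
`[s, t]`, off its closed collar on `[u − ρ, u + ρ] ∖ (s, t)`, and the net passage is
`outerInd (K e^{2πit}) − outerInd (K e^{2πis}) = σ`. [cite: Fulton1995, §3] -/
theorem exists_clean_passage (hφ1 : ∀ u r, φ (u + 1, r) = φ (u, r))
    (hφi : InjOn φ (Ico (0 : ℝ) 1 ×ˢ Ioo (-1 : ℝ) 1)) {k η ρ u : ℝ} {σ : ℤ}
    (hk : k ∈ Ioo (-(1 / 2) : ℝ) (1 / 2)) (hη : 0 < η) (hη4 : η ≤ 1 / 4) (hρ : 0 < ρ)
    (hσ : σ = 1 ∨ σ = -1)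
    (hA : ∀ t ∈ Icc (u - ρ) (u + ρ), K (circlePt t) ∈ φ '' (univ ×ˢ Ioo (-1 : ℝ) 1))
    (hcont : ContinuousOn (fun t => (σ : ℝ) * (height φ (K (circlePt t)) - k)) (Icc (u - ρ) (u + ρ)))
    (hmono : StrictMonoOn (fun t => (σ : ℝ) * (height φ (K (circlePt t)) - k)) (Icc (u - ρ) (u + ρ)))
    (hu : height φ (K (circlePt u)) = k)
    (hend₁ : K (circlePt (u - ρ)) ∉ φ '' (univ ×ˢ Icc (k - η) (k + η)))
    (hend₂ : K (circlePt (u + ρ)) ∉ φ '' (univ ×ˢ Icc (k - η) (k + η))) :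
    ∃ s t, u - ρ ≤ s ∧ s < t ∧ t ≤ u + ρ ∧
      (∀ τ ∈ Icc s t, K (circlePt τ) ∈
        (fun p : ℝ × ℝ => φ (p.1, k + η * p.2)) '' (univ ×ˢ Ioo (-1 : ℝ) 1)) ∧
      (∀ τ ∈ Icc (u - ρ) (u + ρ), τ ∉ Ioo s t → K (circlePt τ) ∉
        (fun p : ℝ × ℝ => φ (p.1, k + η * p.2)) '' (univ ×ˢ Icc (-(1 / 2) : ℝ) (1 / 2))) ∧
      outerInd (fun p : ℝ × ℝ => φ (p.1, k + η * p.2)) (K (circlePt t)) -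
        outerInd (fun p : ℝ × ℝ => φ (p.1, k + η * p.2)) (K (circlePt s)) = σ := by
  have hkη : |k| + η ≤ 1 := by
    have : |k| < 1 / 2 := abs_lt.2 ⟨hk.1, hk.2⟩
    linarith
  have hσ1 : (σ : ℝ) * σ = 1 := by rcases hσ with rfl | rfl <;> norm_num
  have hσabs : ∀ x : ℝ, |(σ : ℝ) * x| = |x| := fun x => by
    rcases hσ with rfl | rfl <;> simp
  set F : ℝ → ℝ := fun t => (σ : ℝ) * (height φ (K (circlePt t)) - k) with hF
  -- heights along the interval, and the relation `height - k = σ F`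
  have hF' : ∀ t, height φ (K (circlePt t)) - k = σ * F t := fun t => by
    simp only [hF, ← mul_assoc, hσ1, one_mul]
  have hI₁ : u - ρ ∈ Icc (u - ρ) (u + ρ) := ⟨le_rfl, by linarith⟩
  have hI₂ : u + ρ ∈ Icc (u - ρ) (u + ρ) := ⟨by linarith, le_rfl⟩
  have hIu : u ∈ Icc (u - ρ) (u + ρ) := ⟨by linarith, by linarith⟩
  have hFu : F u = 0 := by simp only [hF, hu, sub_self, mul_zero]
  -- the end points are beyond the strip: `F (u + ρ) > η`, `F (u - ρ) < -η`
  have hfar : ∀ t ∈ Icc (u - ρ) (u + ρ), K (circlePt t) ∉ φ '' (univ ×ˢ Icc (k - η) (k + η)) →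
      η < |F t| := by
    intro t ht hoff
    obtain ⟨p, ⟨-, hp⟩, hpt⟩ := hA t ht
    have hh : height φ (K (circlePt t)) = p.2 := by
      rw [← hpt]; exact height_of_lift hφ1 hφi (u₀ := p.1) (r₀ := p.2) hp
    have hnot : p.2 ∉ Icc (k - η) (k + η) := fun h => hoff ⟨p, ⟨trivial, h⟩, hpt⟩
    rw [hF]
    dsimp only
    rw [hσabs, hh]
    rcases lt_or_ge p.2 (k - η) with h | h
    · rw [abs_of_neg (by linarith)]; linarith
    · have : k + η < p.2 := by
        by_contra h'
        push Not at h'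
        exact hnot ⟨h, h'⟩
      rw [abs_of_pos (by linarith)]; linarith
  have hF₂ : η < F (u + ρ) := by
    have h1 := hfar _ hI₂ hend₂
    have h2 : F u < F (u + ρ) := hmono hIu hI₂ (by linarith)
    rw [hFu] at h2
    rwa [abs_of_pos h2] at h1
  have hF₁ : F (u - ρ) < -η := by
    have h1 := hfar _ hI₁ hend₁
    have h2 : F (u - ρ) < F u := hmono hI₁ hIu (by linarith)
    rw [hFu] at h2
    rw [abs_of_neg h2] at h1
    linarith
  -- the passage end points by the intermediate value theorem
  obtain ⟨t, ht, hFt⟩ : ∃ t ∈ Icc u (u + ρ), F t = 3 * η / 4 := by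
    have h := intermediate_value_Icc (show u ≤ u + ρ by linarith)
      (hcont.mono (Icc_subset_Icc (by linarith) le_rfl))
    exact h ⟨by rw [hFu]; linarith, by linarith⟩
  obtain ⟨s, hs, hFs⟩ : ∃ s ∈ Icc (u - ρ) u, F s = -(3 * η / 4) := by
    have h := intermediate_value_Icc (show u - ρ ≤ u by linarith)
      (hcont.mono (Icc_subset_Icc le_rfl (by linarith)))
    exact h ⟨by linarith, by rw [hFu]; linarith⟩
  have hsI : s ∈ Icc (u - ρ) (u + ρ) := ⟨hs.1, by linarith [hs.2]⟩
  have htI : t ∈ Icc (u - ρ) (u + ρ) := ⟨by linarith [ht.1], ht.2⟩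
  have hst : s < t := (hmono.lt_iff_lt hsI htI).1 (by rw [hFs, hFt]; linarith)
  refine ⟨s, t, hs.1, hst, ht.2, fun τ hτ => ?_, fun τ hτ hτst => ?_, ?_⟩
  · -- inside the annulus of `φ_{k,η}` on `[s, t]`
    have hτI : τ ∈ Icc (u - ρ) (u + ρ) := ⟨hs.1.trans hτ.1, hτ.2.trans ht.2⟩
    refine mem_annulus_reprofile hη (hA τ hτI) ?_
    have h1 : F s ≤ F τ := hmono.monotoneOn hsI hτI hτ.1
    have h2 : F τ ≤ F t := hmono.monotoneOn hτI htI hτ.2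
    rw [hF', hσabs, abs_lt]
    constructor <;> linarith
  · -- off the collar of `φ_{k,η}` on `[u - ρ, u + ρ] ∖ (s, t)`
    intro hmem
    obtain ⟨-, hle⟩ := height_of_mem_collar_reprofile hφ1 hφi hη hkη hmem
    rw [hF', hσabs] at hle
    have hle' := abs_le.1 hle
    rcases le_or_gt τ s with h | h
    · have h1 : F τ ≤ F s := hmono.monotoneOn hτ hsI h
      linarith
    · have h' : t ≤ τ := by
        by_contra h''
        push Not at h''
        exact hτst ⟨h, h''⟩
      have h1 : F t ≤ F τ := hmono.monotoneOn htI hτ h'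
      linarith
  · -- the net passage
    obtain ⟨p, ⟨-, hp⟩, hpt⟩ := hA t htI
    obtain ⟨q, ⟨-, hq⟩, hqs⟩ := hA s hsI
    have hht : height φ (K (circlePt t)) = p.2 := by
      rw [← hpt]; exact height_of_lift hφ1 hφi (u₀ := p.1) (r₀ := p.2) hp
    have hhs : height φ (K (circlePt s)) = q.2 := by
      rw [← hqs]; exact height_of_lift hφ1 hφi (u₀ := q.1) (r₀ := q.2) hq
    have ep : p.2 = k + η * (σ * (3 / 4)) := by
      have := hF' t
      rw [hht, hFt] at this
      linarith
    have eq : q.2 = k + η * (σ * (-(3 / 4))) := by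
      have := hF' s
      rw [hhs, hFs] at this
      linarith
    have e1 : K (circlePt t) = φ (p.1, k + η * (σ * (3 / 4))) := by rw [← hpt, ← ep]
    have e2 : K (circlePt s) = φ (q.1, k + η * (σ * (-(3 / 4)))) := by rw [← hqs, ← eq]
    rw [e1, e2, outerInd_reprofile hφ1 hφi hη hkη (by
        rcases hσ with rfl | rfl <;> constructor <;> norm_num),
      outerInd_reprofile hφ1 hφi hη hkη (by
        rcases hσ with rfl | rfl <;> constructor <;> norm_num)]
    rcases hσ with rfl | rfl <;> norm_num

/-! ## §5 The registered form -/

/-- **Sub-goal `helper_crossing_clean_passage`** (X7-1a, the local piece of the counting step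
(R1)(iv) of the symmetry statement for node N1a of NF4): one clean passage of a page loop
through the thin re-profiled collar of an annulus chart near a transversal solution of
`height = k`, in registered form. [cite: Fulton1995, §3] -/
theorem helper_crossing_clean_passage : ∀ (g : ℕ) (φ : ℝ × ℝ → Literature.Topology.FourManifolds.LefschetzBase.Base g) (K : Metric.sphere (0 : EuclideanSpace ℝ (Fin 2)) 1 → Literature.Topology.FourManifolds.LefschetzBase.Base g) (k η ρ u : ℝ) (σ : ℤ), (∀ u r, φ (u + 1, r) = φ (u, r)) → Set.InjOn φ (Set.Ico (0 : ℝ) 1 ×ˢ Set.Ioo (-1 : ℝ) 1) → k ∈ Set.Ioo (-(1 / 2) : ℝ) (1 / 2) → 0 < η → η ≤ 1 / 4 → 0 < ρ → (σ = 1 ∨ σ = -1) → (∀ t ∈ Set.Icc (u - ρ) (u + ρ), K (Literature.Topology.FourManifolds.circlePt t) ∈ φ '' (Set.univ ×ˢ Set.Ioo (-1 : ℝ) 1)) → ContinuousOn (fun t => (σ : ℝ) * (Summit.SmoothPoincare4.SmoothPoincare4.Theorems.AcyclicBisectionExists.ModpBraidOrbits.height φ (K (Literature.Topology.FourManifolds.circlePt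 t)) - k)) (Set.Icc (u - ρ) (u + ρ)) → StrictMonoOn (fun t => (σ : ℝ) * (Summit.SmoothPoincare4.SmoothPoincare4.Theorems.AcyclicBisectionExists.ModpBraidOrbits.height φ (K (Literature.Topology.FourManifolds.circlePt t)) - k)) (Set.Icc (u - ρ) (u + ρ)) → Summit.SmoothPoincare4.SmoothPoincare4.Theorems.AcyclicBisectionExists.ModpBraidOrbits.height φ (K (Literature.Topology.FourManifolds.circlePt u)) = k → K (Literature.Topology.FourManifolds.circlePt (u - ρ)) ∉ φ '' (Set.univ ×ˢ Set.Icc (k - η) (k + η)) → K (Literature.Topology.FourManifolds.circlePt (u + ρ)) ∉ φ '' (Set.univ ×ˢ Set.Icc (k - η) (k + η)) → ∃ s t, u - ρ ≤ s ∧ s < t ∧ t ≤ u + ρ ∧ (∀ τ ∈ Set.Icc s t, K (Literature.Topology.FourManifolds.circlePt τ) ∈ (fun p : ℝ × ℝ => φ (p.1, k + η * p.2)) '' (Set.univ ×ˢ Set.Ioo (-1 : ℝ) 1)) ∧ (∀ τ ∈ Set.Icc (u - ρ) (u + ρ), τ ∉ Set.Ioo s t → K (Literature.Topology.FourManifolds.circlePt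 τ) ∉ (fun p : ℝ × ℝ => φ (p.1, k + η * p.2)) '' (Set.univ ×ˢ Set.Icc (-(1 / 2) : ℝ) (1 / 2))) ∧ Summit.SmoothPoincare4.SmoothPoincare4.Theorems.AcyclicBisectionExists.ModpBraidOrbits.outerInd (fun p : ℝ × ℝ => φ (p.1, k + η * p.2)) (K (Literature.Topology.FourManifolds.circlePt t)) - Summit.SmoothPoincare4.SmoothPoincare4.Theorems.AcyclicBisectionExists.ModpBraidOrbits.outerInd (fun p : ℝ × ℝ => φ (p.1, k + η * p.2)) (K (Literature.Topology.FourManifolds.circlePt s)) = σ :=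
  fun _ _ _ _ _ _ _ _ hφ1 hφi hk hη hη4 hρ hσ hA hcont hmono hu hend₁ hend₂ =>
    exists_clean_passage hφ1 hφi hk hη hη4 hρ hσ hA hcont hmono hu hend₁ hend₂

end Summit.SmoothPoincare4.SmoothPoincare4.Theorems.AcyclicBisectionExists.ModpBraidOrbits

end
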